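import Summits.ResolutionOfSingularities.ResolutionOfSingularities.Theses.Valuative
import Summits.ResolutionOfSingularities.ResolutionOfSingularities.Theorems.RegularBlowupsDesingularization
import Literature.AlgebraicGeometry.Resolution.EmbeddedResolutionCentre
import Literature.AlgebraicGeometry.Resolution.ProperModelsPatchingOfResolution
import Literature.AlgebraicGeometry.Resolution.ZariskiPatchingProperModels
import Literature.AlgebraicGeometry.Resolution.ProjectiveBirationalBlowupProofs
import Literature.AlgebraicGeometry.Resolution.EmbeddedResolutionExcellentSurfaces
import Literature.AlgebraicGeometry.Resolution.QuasiProjectiveReduction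
import Literature.AlgebraicGeometry.Motives.ProjectiveSpaceCoordinateEmbedding
import Literature.AlgebraicGeometry.Motives.VarietiesDimensionProofs
import HarnessLib

/-!
# Crux `PatchingRel` (stmt-ResolutionOfSingularities-0642) — line `Ideator5Sketch`
# (card `bad-stratum-induction`), SKELETON v1.4 (lead a3, 2026-08-17): S1 PROVED inline, line collapses onto S3

The picked line is crux-ideate round 2, ideator 5 (`Cruxes/PatchingRel/Ideator5Sketch.lean`):
Zariski's bad-curve induction of the tree (trdeg 3, `twoModelPatching_of_principalization`)
re-run in transcendence degree `n`, with Axiom 4 := `PrincipalizationInChar`, an embedded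
resolution of the bad `(n-2)`-folds (`EmbResCodimTwo`) and a termination lemma, composed over the
tree's dimension-free Zariski programme `resolutionInChar_of_properTwoModelPatching_of_relLU`
(which consumes the crux's antecedent `LUrel_p`, Piltant's Axiom 5).

Registered stubs (the four inputs of the card's composition `patchingRel_of_badStratumInduction`;
the fourth, `Liu2002Thm8124Projective`, is DISCHARGED in the tree,
`Liu2002Thm8124Projective_holds`, and is not a stub):

* S1 `stub_badStratumPatching : ∀ p prime, BadStratumPatching.{0} p` — the card's hardest stub
  (lead);
* S2 `stub_principalizationInChar : ∀ p prime, PrincipalizationInChar.{0} p` — Piltant's Axiom 4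
  in blow-up format (tree `@[conjecture]`, `Theorems/RegularBlowupsDesingularization.lean`; open
  in dimension `≥ 4`);
* S3 `stub_embResCodimTwo : ∀ p prime, EmbResCodimTwo.{0} p` — CJS-format embedded resolution in
  codimension `≥ 2` (Cossart–Jannsen–Saito 2020 Thm. 1.4 for ambient dimension `≤ 4`; open for
  ambient dimension `≥ 5`).

`PatchingRel_of` is the card's composition `patchingRel_of_badStratumInduction`, inlined and fed with
S1–S3 and `Liu2002Thm8124Projective_holds`.
-/

set_option linter.dupNamespace false

noncomputable section

namespace Summit.ResolutionOfSingularities.ResolutionOfSingularities.Cruxes.PatchingRel.BadStratumInductionLine.Aux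

/-! ## Inlined copy of `Theorems/ValuativePatchingRelEmbeddedTransformSelf.lean` (p142839, landed) —
kept here only so that this workfile elaborates before the farm has built that module. -/


open CategoryTheory AlgebraicGeometry TopologicalSpace Topology
open Literature.AlgebraicGeometry.Resolution
open Scheme.IdealSheafData

universe u

variable {X : Scheme.{u}}

/-! ## (3) ⇒ (4) from explicit data -/

/-- **BGMW §3.3 (3) ⇒ (4) from explicit data.** Let `ι : Y ↪ X` be a closed immersion of an
integral scheme, `σ : X' → X` proper and an isomorphism over an open `V` containing
`ξ = ι(η_Y)`, and `ξ' ∈ X'` a point over `ξ`. If the reduced closed subscheme `Ỹ` of `X'` on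
`closure {ξ'}` is regular, then `Ỹ → Y` (the factorisation of `Ỹ ↪ X' → X` through `ι`) is a
resolution of singularities of `Y`: proper, birational (a surjective closed immersion onto the
reduced `ι⁻¹ V`, hence an isomorphism over it), with regular source. The argument is the tree's
`hasResolution_of_isEmbeddedTransform` with its first line (the appeal to
`IsEmbeddedTransform.isProper_and_exists`) replaced by hypotheses.
[cite: BierstoneGrigorievMilmanWlodarczyk2011, §3.3 (3)⇒(4) and Thm. 2.0.3] -/
theorem hasResolution_of_isIso_over_generic {Y X' : Scheme.{u}} [IsIntegral Y] (ι : Y ⟶ X)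
    [IsClosedImmersion ι] (σ : X' ⟶ X) [IsProper σ] (V : X.Opens)
    (hξV : ι (genericPoint Y) ∈ V) (hiso : IsIso (σ ∣_ V)) (ξ' : X')
    (hξ' : σ ξ' = ι (genericPoint Y))
    (hreg : Scheme.IsRegular
      (vanishingIdeal (⟨closure {ξ'}, isClosed_closure⟩ : Closeds X')).subscheme) :
    Scheme.HasResolution Y := by
  classical
  -- `ι(Y)` is the closure of the image `ξ` of the generic point of `Y`
  set ξ : X := ι (genericPoint Y) with hξdef
  have hgen : IsGenericPoint ξ (Set.range ι) := by
    have := (genericPoint_spec Y).image ι.continuous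
    rwa [Set.image_univ, ι.isClosedEmbedding.isClosed_range.closure_eq] at this
  have hYξ : Set.range ι = closure {ξ} := hgen.symm
  -- the strict transform `Z = closure {ξ'}` and its reduced structure `Ỹ`
  set Z : Closeds X' := ⟨closure {ξ'}, isClosed_closure⟩ with hZdef
  have hZ : (Z : Set X') = closure {ξ'} := rfl
  let j := (vanishingIdeal Z).subschemeι
  haveI : IsIntegral (vanishingIdeal Z).subscheme :=
    isIntegral_subscheme_vanishingIdeal Z (hZ ▸ isIrreducible_singleton.closure)
  have hrange : Set.range j = closure {ξ'} := by
    rw [range_subschemeι, coe_support_vanishingIdeal, hZ]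
  -- `σ ∘ j` factors through `ι`
  have hker : ι.ker ≤ (j ≫ σ).ker := by
    have e1 : (j ≫ σ).ker = vanishingIdeal (.closure (σ '' (Z : Set X'))) := by
      rw [← map_vanishingIdeal]
      rfl
    rw [e1, ← le_support_iff_le_vanishingIdeal]
    have e2 : (ι.ker.support : Set X) = Set.range ι := by
      rw [Scheme.Hom.support_ker, ι.isClosedEmbedding.isClosed_range.closure_eq]
    rw [← SetLike.coe_subset_coe, e2, Closeds.closure]
    change closure (σ '' (Z : Set X')) ⊆ Set.range ι
    rw [hYξ, hZ]
    refine closure_minimal ((image_closure_subset_closure_image σ.continuous).trans ?_)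
      isClosed_closure
    rw [Set.image_singleton, hξ']
  let ρ : (vanishingIdeal Z).subscheme ⟶ Y := IsClosedImmersion.lift ι (j ≫ σ) hker
  have hρ : ρ ≫ ι = j ≫ σ := IsClosedImmersion.lift_fac ι (j ≫ σ) hker
  have hρapp : ∀ y, ι (ρ y) = σ (j y) := fun y => by
    rw [← Scheme.Hom.comp_apply, hρ, Scheme.Hom.comp_apply]
  -- properness
  haveI : IsProper ρ := by
    have : IsProper (ρ ≫ ι) := by rw [hρ]; infer_instance
    exact MorphismProperty.of_postcomp (W := @IsProper) (W' := @IsSeparated) ρ ι inferInstance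
      this
  -- the dense open `U = ι⁻¹ V` of `Y` and the point `y₀` of `Ỹ` over `ξ'`
  let U : Y.Opens := ι ⁻¹ᵁ V
  have hηU : genericPoint Y ∈ U := hξV
  obtain ⟨y₀, hy₀⟩ : ξ' ∈ Set.range j := by rw [hrange]; exact subset_closure rfl
  have hfibξ : σ ⁻¹' {ξ} = {ξ'} := by
    obtain ⟨x, -, huniq⟩ := existsUnique_preimage_of_isIso_morphismRestrict σ hiso hξV
    ext z
    simp only [Set.mem_preimage, Set.mem_singleton_iff]
    exact ⟨fun hz => (huniq z hz).trans (huniq ξ' hξ').symm, fun hz => hz ▸ hξ'⟩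
  -- points of `X'` over `ι(Y) ∩ V` lie in the strict transform
  have hover : ∀ x : X', σ x ∈ Set.range ι → σ x ∈ V → x ∈ closure {ξ'} := by
    intro x hx hxV
    rw [hYξ] at hx
    have := preimage_closure_inter_subset_of_isIso_morphismRestrict σ hiso {ξ} ⟨hx, hxV⟩
    rwa [hfibξ] at this
  have hbir : IsBirational ρ := by
    refine ⟨U, ?_, ?_, ?_⟩
    · -- `U` contains the generic point of `Y`
      have hd : Dense ({genericPoint Y} : Set Y) := by
        rw [dense_iff_closure_eq]; exact genericPoint_spec Y
      exact hd.mono (Set.singleton_subset_iff.mpr hηU)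
    · -- `ρ⁻¹ U` contains the generic point `y₀` of `Ỹ`
      have hgen' : closure ({y₀} : Set (vanishingIdeal Z).subscheme) = Set.univ := by
        rw [j.isClosedEmbedding.isInducing.closure_eq_preimage_closure_image, Set.image_singleton,
          hy₀, ← hrange, Set.preimage_range]
      have hd : Dense ({y₀} : Set (vanishingIdeal Z).subscheme) := by
        rw [dense_iff_closure_eq]; exact hgen'
      refine hd.mono (Set.singleton_subset_iff.mpr ?_)
      change ι (ρ y₀) ∈ V
      rw [hρapp, hy₀, hξ']
      exact hξV
    · -- over `U`, `ρ` is a surjective closed immersion onto a reduced scheme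
      haveI : IsClosedImmersion (ρ ∣_ U) := by
        have h1 : IsClosedImmersion ((j ≫ σ) ∣_ V) := by
          rw [morphismRestrict_comp]
          haveI := hiso
          exact (MorphismProperty.cancel_right_of_respectsIso @IsClosedImmersion _ _).mpr
            (IsZariskiLocalAtTarget.restrict (inferInstanceAs (IsClosedImmersion j)) _)
        rw [← hρ, morphismRestrict_comp] at h1
        exact MorphismProperty.of_postcomp (W := @IsClosedImmersion) (W' := @IsSeparated)
          (ρ ∣_ U) (ι ∣_ V) inferInstance h1
      haveI : Surjective (ρ ∣_ U) := by
        refine ⟨fun u => ?_⟩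
        have hu : ι u.1 ∈ V := u.2
        obtain ⟨x, hx, -⟩ := existsUnique_preimage_of_isIso_morphismRestrict σ hiso hu
        have hxZ : x ∈ Set.range j := by
          rw [hrange]
          exact hover x (hx ▸ Set.mem_range_self _) (hx ▸ hu)
        obtain ⟨y₁, rfl⟩ := hxZ
        have hρy₁ : ρ y₁ = u.1 := ι.isClosedEmbedding.injective (by rw [hρapp, hx])
        refine ⟨⟨y₁, show ρ y₁ ∈ U by rw [hρy₁]; exact u.2⟩, Subtype.ext ?_⟩
        rw [morphismRestrict_base_coe]
        exact hρy₁
      exact isIso_of_isClosedImmersion_of_surjective _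
  exact ⟨_, ρ, ⟨inferInstance, hbir, hreg⟩⟩

/-! ## (2) ⇒ (3) from explicit data: a regular centre through the point over `ξ` -/

/-- **BGMW §3.3 (2) ⇒ (3) from explicit data.** Let `σ : X' → X` be an isomorphism over an open
`V ∋ ξ`, `ξ' ∈ X'` the point over `ξ`, and `V(C) ⊆ X'` a REGULAR closed subscheme lying over
`closure {ξ}` and passing through `ξ'` (`X'` locally Noetherian). Then the reduced closed
subscheme of `X'` on `closure {ξ'}` is regular: over `V`, both `V(C)` and `closure {ξ'}` coincide
with `σ⁻¹(closure {ξ})`, so `closure {ξ'}` is the closure of the open piece `V(C) ∩ σ⁻¹ V` of the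
regular scheme `V(C)` (`Scheme.IsRegular.subscheme_vanishingIdeal_closure`). This is the tree's
`IsEmbeddedTransform.isRegular_subscheme_of_centre` with its first line replaced by hypotheses.
[cite: BierstoneGrigorievMilmanWlodarczyk2011, §3.3 (2)⇒(3), p. 7] -/
theorem isRegular_subscheme_closure_of_centre {X' : Scheme.{u}} [IsLocallyNoetherian X']
    {ξ : X} (σ : X' ⟶ X) (V : X.Opens) (hξV : ξ ∈ V) (hiso : IsIso (σ ∣_ V)) (ξ' : X')
    (hξ' : σ ξ' = ξ) (C : X'.IdealSheafData) (hC : Scheme.IsRegular C.subscheme)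
    (hCY : σ '' (C.support : Set X') ⊆ closure {ξ}) (hξ'C : ξ' ∈ (C.support : Set X')) :
    Scheme.IsRegular (Scheme.IdealSheafData.vanishingIdeal
      (⟨closure {ξ'}, isClosed_closure⟩ : Closeds X')).subscheme := by
  haveI : IsLocallyNoetherian C.subscheme :=
    LocallyOfFiniteType.isLocallyNoetherian C.subschemeι
  -- the fibre of `σ` over `ξ` is `{ξ'}`
  have hfib : σ ⁻¹' {ξ} = {ξ'} := by
    obtain ⟨x, -, huniq⟩ := existsUnique_preimage_of_isIso_morphismRestrict σ hiso hξV
    ext z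
    simp only [Set.mem_preimage, Set.mem_singleton_iff]
    exact ⟨fun hz => (huniq z hz).trans (huniq ξ' hξ').symm, fun hz => hz ▸ hξ'⟩
  -- over `V`, the centre coincides with `closure {ξ'}`
  let W : X'.Opens := σ ⁻¹ᵁ V
  have hCW : (C.support : Set X') ∩ (W : Set X') = closure {ξ'} ∩ (W : Set X') := by
    apply le_antisymm
    · rintro x ⟨hxC, hxW⟩
      refine ⟨?_, hxW⟩
      have hx : σ x ∈ closure {ξ} := hCY ⟨x, hxC, rfl⟩
      have := preimage_closure_inter_subset_of_isIso_morphismRestrict σ hiso {ξ} ⟨hx, hxW⟩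
      rwa [hfib] at this
    · rintro x ⟨hx, hxW⟩
      exact ⟨closure_minimal (Set.singleton_subset_iff.mpr hξ'C) C.support.isClosed hx, hxW⟩
  have hcl : closure ((C.support : Set X') ∩ (W : Set X')) = closure {ξ'} := by
    rw [hCW]
    apply le_antisymm
    · simpa only [closure_closure] using
        closure_mono (s := closure {ξ'} ∩ (W : Set X')) (t := closure {ξ'}) Set.inter_subset_left
    · refine closure_mono (Set.singleton_subset_iff.mpr ⟨subset_closure rfl, ?_⟩)
      show σ ξ' ∈ V
      rw [hξ']
      exact hξV
  -- `closure {ξ'}` is the closure of an open piece of the regular scheme `V(C)`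
  have key := hC.subscheme_vanishingIdeal_closure C.subschemeι W
  have e : (⟨closure (Set.range C.subschemeι ∩ (W : Set X')), isClosed_closure⟩ : Closeds X') =
      ⟨closure {ξ'}, isClosed_closure⟩ := by
    apply Closeds.ext
    change closure (Set.range C.subschemeι ∩ (W : Set X')) = closure {ξ'}
    rw [Scheme.IdealSheafData.range_subschemeι, hcl]
  rwa [e] at key

/-! ## The induction over the sequence of blow-ups -/

/-- **Embedded transforms with centres over the subvariety: the dichotomy.** Let `X` be locally
Noetherian, `ι : Y ↪ X` a closed immersion of an integral scheme with generic point mapping to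
`ξ`, and `σ : X' → X`, `Y' ⊆ X'` an embedded transform of `ι(Y)` along blow-ups in regular
centres lying over a set `T ⊆ ι(Y)` (`IsEmbeddedTransform (range ι) T σ Y'`). Then `σ` is proper
(blow-ups of locally Noetherian schemes are proper, `stacks02NS_holds`), and EITHER `σ` is an
isomorphism over an open `V ∋ ξ` and `Y' = closure {ξ'}` for a point `ξ'` over `ξ` (no centre
has met the fibre over `ξ` yet), OR `Y` has a resolution of singularities (at the first centre
meeting that fibre the strict transform was regular, `isRegular_subscheme_closure_of_centre`,
and resolves `Y`, `hasResolution_of_isIso_over_generic`).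
[cite: BierstoneGrigorievMilmanWlodarczyk2011, §3.3 (2)⇒(3)⇒(4)] -/
theorem isProper_and_exists_or_hasResolution [IsLocallyNoetherian X] {Y : Scheme.{u}}
    [IsIntegral Y] (ι : Y ⟶ X) [IsClosedImmersion ι] {T : Set X} (hT : T ⊆ Set.range ι)
    {X' : Scheme.{u}} {σ : X' ⟶ X} {Y' : Set X'}
    (h : IsEmbeddedTransform (Set.range ι) T σ Y') :
    IsProper σ ∧
      ((∃ V : X.Opens, ι (genericPoint Y) ∈ V ∧ IsIso (σ ∣_ V) ∧
          ∃ ξ' : X', σ ξ' = ι (genericPoint Y) ∧ Y' = closure {ξ'}) ∨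
        Scheme.HasResolution Y) := by
  -- `ι(Y)` is the closure of `ξ`
  set ξ : X := ι (genericPoint Y) with hξdef
  have hgen : IsGenericPoint ξ (Set.range ι) := by
    have := (genericPoint_spec Y).image ι.continuous
    rwa [Set.image_univ, ι.isClosedEmbedding.isClosed_range.closure_eq] at this
  have hYξ : Set.range ι = closure {ξ} := hgen.symm
  induction h with
  | refl =>
    refine ⟨inferInstance, Or.inl ⟨⊤, trivial, ?_, ξ, rfl, hYξ⟩⟩
    infer_instance
  | @blowup X' X'' σ Y' h C τ hτ hC hCT ih =>
    obtain ⟨hσ, hcase⟩ := ih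
    haveI : IsLocallyNoetherian X' := LocallyOfFiniteType.isLocallyNoetherian σ
    haveI : IsProper τ := stacks02NS_holds.of_isLocallyNoetherian τ C hτ
    refine ⟨inferInstance, ?_⟩
    rcases hcase with ⟨V, hξV, hiso, ξ', hξ', hY'⟩ | hres
    · -- the fibre of `σ` over `ξ` is `{ξ'}`
      have hfib : σ ⁻¹' {ξ} = {ξ'} := by
        obtain ⟨x, -, huniq⟩ := existsUnique_preimage_of_isIso_morphismRestrict σ hiso hξV
        ext z
        simp only [Set.mem_preimage, Set.mem_singleton_iff]
        exact ⟨fun hz => (huniq z hz).trans (huniq ξ' hξ').symm, fun hz => hz ▸ hξ'⟩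
      -- the centre lies over `ι(Y) = closure {ξ}`
      have hCY : σ '' (C.support : Set X') ⊆ closure {ξ} := fun x hx => hYξ ▸ hT (hCT hx)
      by_cases hξ'C : ξ' ∈ (C.support : Set X')
      · -- the centre swallows the strict transform, which is therefore regular: resolve `Y` now
        right
        have hreg := isRegular_subscheme_closure_of_centre σ V hξV hiso ξ' hξ' C hC hCY hξ'C
        haveI := hσ
        exact hasResolution_of_isIso_over_generic ι σ V hξV hiso ξ' hξ' hreg
      · -- the centre misses the fibre over `ξ`: shrink `V` and follow `ξ'` up the blow-up
        left
        have hclosed : IsClosed (σ '' (C.support : Set X')) := σ.isClosedMap _ C.support.isClosed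
        let V' : X.Opens := V ⊓ ⟨(σ '' (C.support : Set X'))ᶜ, hclosed.isOpen_compl⟩
        have hV'V : V' ≤ V := inf_le_left
        have hξV' : ξ ∈ V' := by
          refine ⟨hξV, ?_⟩
          rintro ⟨x, hxC, hx⟩
          have hx' : x ∈ σ ⁻¹' {ξ} := hx
          rw [hfib, Set.mem_singleton_iff] at hx'
          exact hξ'C (hx' ▸ hxC)
        -- `τ` is an isomorphism off the centre, in particular over `σ ⁻¹ V'`
        let Wc : X'.Opens := ⟨(C.support : Set X')ᶜ, C.support.isClosed.isOpen_compl⟩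
        have hWc : IsIso (τ ∣_ Wc) := hτ.isIso_morphismRestrict disjoint_compl_left
        have hle : σ ⁻¹ᵁ V' ≤ Wc := fun x hx hxC => hx.2 ⟨x, hxC, rfl⟩
        have hiso' : IsIso ((τ ≫ σ) ∣_ V') := by
          rw [morphismRestrict_comp]
          have h1 := isIso_morphismRestrict_of_le σ hiso hV'V
          have h2 := isIso_morphismRestrict_of_le τ hWc hle
          exact @IsIso.comp_isIso _ _ _ _ _ _ _ h2 h1
        -- the point over `ξ'`
        obtain ⟨ξ₂, hξ₂, huniq⟩ :=
          existsUnique_preimage_of_isIso_morphismRestrict τ hWc (y := ξ') hξ'C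
        have hfib' : τ ⁻¹' {ξ'} = {ξ₂} := by
          ext z
          simp only [Set.mem_preimage, Set.mem_singleton_iff]
          exact ⟨fun hz => huniq z hz, fun hz => hz ▸ hξ₂⟩
        refine ⟨V', hξV', hiso', ξ₂, by rw [Scheme.Hom.comp_apply, hξ₂, hξ'], ?_⟩
        apply le_antisymm
        · refine closure_minimal ?_ isClosed_closure
          rintro x ⟨hxY, hxC⟩
          rw [hY'] at hxY
          have hx :=
            preimage_closure_inter_subset_of_isIso_morphismRestrict τ hWc {ξ'} ⟨hxY, hxC⟩
          rwa [hfib'] at hx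
        · refine closure_mono (Set.singleton_subset_iff.mpr ?_)
          refine ⟨?_, ?_⟩
          · rw [hY']
            show τ ξ₂ ∈ closure {ξ'}
            rw [hξ₂]
            exact subset_closure rfl
          · show τ ξ₂ ∉ (C.support : Set X')
            rw [hξ₂]
            exact hξ'C
    · exact Or.inr hres

/-- **Embedded desingularization with centres over the subvariety ⇒ resolution** (BGMW §3.3
(3) ⇒ (4), generalised from "centres off the generic point" to "centres over `T ⊆ ι(Y)`", the
format of Cossart–Jannsen–Saito 2020, Thm. 1.4, whose centres lie inside the subscheme being
resolved). Let `ι : Y ↪ X` be a closed immersion of an integral scheme into a locally Noetherian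
scheme, `σ : X' → X` a composite of blow-ups in regular centres lying over `T ⊆ ι(Y)`, and
`Y' ⊆ X'` the iterated strict transform of `ι(Y)`. If the reduced closed subscheme of `X'` on
`closure Y'` is regular, then `Y` has a resolution of singularities.
[cite: BierstoneGrigorievMilmanWlodarczyk2011, §3.3 (3)⇒(4) and Thm. 2.0.3]
[cite: CossartJannsenSaito2020, Thm. 1.4] -/
theorem hasResolution_of_isEmbeddedTransform_of_subset [IsLocallyNoetherian X] {Y X' : Scheme.{u}}
    [IsIntegral Y] (ι : Y ⟶ X) [IsClosedImmersion ι] {T : Set X} (hT : T ⊆ Set.range ι)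
    {σ : X' ⟶ X} {Y' : Set X'} (h : IsEmbeddedTransform (Set.range ι) T σ Y')
    (hreg : Scheme.IsRegular
      (vanishingIdeal (⟨closure Y', isClosed_closure⟩ : Closeds X')).subscheme) :
    Scheme.HasResolution Y := by
  obtain ⟨hσ, hcase⟩ := isProper_and_exists_or_hasResolution ι hT h
  rcases hcase with ⟨V, hξV, hiso, ξ', hξ', hY'⟩ | hres
  · haveI := hσ
    have e : (⟨closure Y', isClosed_closure⟩ : Closeds X') = ⟨closure {ξ'}, isClosed_closure⟩ := by
      apply Closeds.ext
      change closure Y' = closure {ξ'}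
      rw [hY', closure_closure]
    rw [e] at hreg
    exact hasResolution_of_isIso_over_generic ι σ V hξV hiso ξ' hξ' hreg
  · exact hres

end Summit.ResolutionOfSingularities.ResolutionOfSingularities.Cruxes.PatchingRel.BadStratumInductionLine.Aux

namespace Summit.ResolutionOfSingularities.ResolutionOfSingularities.Cruxes.PatchingRel.BadStratumInductionLine

open CategoryTheory CategoryTheory.Limits AlgebraicGeometry TopologicalSpace
open Summit.ResolutionOfSingularities.ResolutionOfSingularities.Cruxes.PatchingRel.BadStratumInductionLine.Aux
open Literature.AlgebraicGeometry.Resolution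
open Scheme.IdealSheafData

universe u

/-- **Axiom 3 in transcendence degree `n` — embedded resolution in codimension `≥ 2`**
(Cossart–Jannsen–Saito 2020, Thm. 1.4 with `B = ∅`, conclusion shape of the tree's
`CossartJannsenSaito2020Embedded.of_isClosed`, for closed subsets of codimension `≥ 2` of a
regular variety over a field of characteristic `p`): for `Z` regular integral separated of finite
type over `k` and `X ⊆ Z` closed with `dim X + 2 ≤ dim Z` there is `π : Z₁ ⟶ Z` proper
surjective, a composite of blow-ups in regular centres over `X` (`IsEmbeddedTransform`), an
isomorphism over `Z ∖ X`, with `Z₁` regular, the iterated strict transform `X₁` regular, `B₁` a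
strict normal crossings divisor, `π⁻¹ X = X₁ ∪ B₁` and `X₁` transversal with `B₁`. KNOWN for
`dim Z ≤ 4` (CJS Thm. 1.4); OPEN for `dim Z ≥ 5`. Verbatim from the card's sketch
(`Cruxes/PatchingRel/Ideator5Sketch.lean`). [cite: CossartJannsenSaito2020, Thm. 1.4] -/
def EmbResCodimTwo (p : ℕ) : Prop :=
  ∀ (k : Type u) [Field k] [CharP k p] (Z : Scheme.{u}) (f : Z ⟶ Spec (.of k)) [IsNoetherian Z],
    IsSeparated f → LocallyOfFiniteType f → QuasiCompact f → IsIntegral Z → Scheme.IsRegular Z →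
    ∀ (X : Set Z), IsClosed X → topologicalKrullDim X + 2 ≤ topologicalKrullDim Z →
      ∃ (Z₁ : Scheme.{u}) (π : Z₁ ⟶ Z) (X₁ B₁ : Set Z₁),
        IsEmbeddedTransform X X π X₁ ∧
        Scheme.IsRegular Z₁ ∧ IsProper π ∧ Function.Surjective π ∧
        (∃ U : Z.Opens, (U : Set Z) = Xᶜ ∧ IsIso (π ∣_ U)) ∧
        Scheme.IsRegular (vanishingIdeal ⟨closure X₁, isClosed_closure⟩).subscheme ∧
        IsStrictNormalCrossingsDivisor Z₁ B₁ ∧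
        π ⁻¹' X = X₁ ∪ B₁ ∧
        IsTransversalWith Z₁ X₁ B₁

/-- **Zariski's bad-stratum induction in transcendence degree `n`** (the card's registered
stub-to-be, verbatim from `Cruxes/PatchingRel/Ideator5Sketch.lean`): two-model patching of proper
models from Liu 8.1.24, Axiom 4 = `PrincipalizationInChar` and `EmbResCodimTwo`.
[cite: Piltant2013, Prop. 5.1] -/
def BadStratumPatching (p : ℕ) : Prop :=
  Liu2002Thm8124Projective.{u} → PrincipalizationInChar.{u} p → EmbResCodimTwo.{u} p →
    ProperModel.TwoModelPatching.{u} p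

/-! ## `EmbResCodimTwo p` resolves closed subvarieties of codimension `≥ 2` of regular varieties -/

/-- **CJS-format embedded resolution in codimension `≥ 2` resolves the subvariety.** Under
`EmbResCodimTwo p`: for `k` of characteristic `p`, `Z` a regular integral Noetherian separated
`k`-scheme of finite type and `i : X ↪ Z` a closed immersion of an integral scheme with
`dim i(X) + 2 ≤ dim Z`, the scheme `X` has a resolution of singularities — the output of
`EmbResCodimTwo` on the closed set `i(X)` is an embedded transform with centres over `i(X)` and
regular final strict transform, and `hasResolution_of_isEmbeddedTransform_of_subset` applies with
`T = i(X)`. [cite: BierstoneGrigorievMilmanWlodarczyk2011, §3.3 (3)⇒(4)]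
[cite: CossartJannsenSaito2020, Thm. 1.4] -/
theorem hasResolution_of_embResCodimTwo {p : ℕ} (hE : EmbResCodimTwo.{u} p) {k : Type u}
    [Field k] [CharP k p] {Z X : Scheme.{u}} (f : Z ⟶ Spec (.of k)) [IsNoetherian Z]
    [IsSeparated f] [LocallyOfFiniteType f] [QuasiCompact f] [IsIntegral Z]
    (hZ : Scheme.IsRegular Z) (i : X ⟶ Z) [IsClosedImmersion i] [IsIntegral X]
    (hdim : topologicalKrullDim (Set.range i) + 2 ≤ topologicalKrullDim Z) :
    Scheme.HasResolution X := by
  obtain ⟨Z₁, π, X₁, B₁, hET, -, -, -, -, hreg, -, -, -⟩ :=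
    hE k Z f ‹_› ‹_› ‹_› ‹_› hZ (Set.range i) i.isClosedEmbedding.isClosed_range hdim
  exact hasResolution_of_isEmbeddedTransform_of_subset i subset_rfl hET hreg

/-! ## `EmbResCodimTwo p → ResolutionInChar p` -/

/-- **The line's Axiom-3 hypothesis is summit-strength: `EmbResCodimTwo p → ResolutionInChar p`.**
By `resolutionInChar_iff_forall_immersion_projectiveSpace` it suffices to resolve every integral
`X` with an immersion `ι : X → 𝐏ⁿ_k` (`char k = p`). Compose `ι` with two coordinate-hyperplane
embeddings `𝐏ⁿ_k ↪ 𝐏ⁿ⁺¹_k ↪ 𝐏ⁿ⁺²_k` (`ProjectiveSpace.skipMap`, closed immersions); the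
composite immersion is a closed immersion into the open `U = coborderRange ⊆ 𝐏ⁿ⁺²_k`, which is
a regular integral Noetherian separated `k`-scheme of finite type with `dim U = n + 2`
(`Motives.topologicalKrullDim_eq_of_smoothOfRelativeDimension`), while `dim X ≤ dim 𝐏ⁿ_k = n`
(`IsInducing.topologicalKrullDim_le`); now apply `hasResolution_of_embResCodimTwo`.
[cite: Kollar2007, Thm. 3.36 from Cor. 3.22] [cite: CossartJannsenSaito2020, Thm. 1.4] -/
theorem resolutionInChar_of_embResCodimTwo {p : ℕ} (hE : EmbResCodimTwo.{u} p) :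
    ResolutionInChar.{u} p := by
  rw [resolutionInChar_iff_forall_immersion_projectiveSpace]
  intro k _ _ n X ι hι hX
  haveI := hι
  haveI := hX
  -- the ambient projective spaces
  let P : ℕ → Scheme.{u} := fun m => (Literature.AlgebraicGeometry.Motives.projectiveSpace m k).left
  let g : ∀ m : ℕ, P m ⟶ Spec (.of k) :=
    fun m => (Literature.AlgebraicGeometry.Motives.projectiveSpace m k).hom
  -- re-embed `𝐏ⁿ ↪ 𝐏ⁿ⁺²`
  let s : P n ⟶ P (n + 2) :=
    (Literature.AlgebraicGeometry.Motives.ProjectiveSpace.skipMap (k := k) (n := n) 0).left ≫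
      (Literature.AlgebraicGeometry.Motives.ProjectiveSpace.skipMap (k := k) (n := n + 1) 0).left
  haveI : IsClosedImmersion s := inferInstance
  let ι₂ : X ⟶ P (n + 2) := ι ≫ s
  haveI : IsImmersion ι₂ := inferInstance
  -- `X` is closed in the open `U ⊆ 𝐏ⁿ⁺²`
  let U : (P (n + 2)).Opens := ι₂.coborderRange
  let i : X ⟶ (U : Scheme.{u}) := ι₂.liftCoborder
  haveI : IsClosedImmersion i := inferInstance
  -- the ambient `U`: regular, integral, Noetherian, separated of finite type over `k`
  obtain ⟨hs, hsep, hqc, hreg⟩ :=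
    smooth_isSeparated_quasiCompact_isRegular_opens_projectiveSpace (k := k) (n + 2) U
  haveI := hs
  haveI := hsep
  haveI := hqc
  haveI : LocallyOfFiniteType (U.ι ≫ g (n + 2)) := inferInstance
  haveI : IsProper (g (n + 2)) := Literature.AlgebraicGeometry.Motives.isProper_projectiveSpace (n + 2) k
  haveI : IsLocallyNoetherian (P (n + 2)) := LocallyOfFiniteType.isLocallyNoetherian (g (n + 2))
  haveI : CompactSpace (P (n + 2)) := QuasiCompact.compactSpace_of_compactSpace (g (n + 2))
  haveI : IsNoetherian (P (n + 2)) := {}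
  haveI : IsIntegral (P (n + 2)) := isIntegral_projectiveSpace (n + 2) k
  haveI : Nonempty X := inferInstance
  haveI : Nonempty (U : Scheme.{u}) := ⟨i (Classical.arbitrary X)⟩
  haveI : IsIntegral (U : Scheme.{u}) := isIntegral_of_isOpenImmersion U.ι
  haveI : CompactSpace (U : Scheme.{u}) := QuasiCompact.compactSpace_of_compactSpace (U.ι ≫ g (n + 2))
  haveI : IsNoetherian (U : Scheme.{u}) := {}
  -- dimensions: `dim U = n + 2`
  haveI : SmoothOfRelativeDimension (n + 2) (g (n + 2)) :=
    (Literature.AlgebraicGeometry.Motives.isSmoothProjective_projectiveSpace_holds k (n + 2))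
      |>.smoothOfRelativeDimension
  haveI : SmoothOfRelativeDimension (0 + (n + 2)) (U.ι ≫ g (n + 2)) := inferInstance
  have hU : topologicalKrullDim (U : Scheme.{u}) = ((n + 2 : ℕ) : WithBot ℕ∞) := by
    have h := Literature.AlgebraicGeometry.Motives.topologicalKrullDim_eq_of_smoothOfRelativeDimension
      (U.ι ≫ g (n + 2)) (0 + (n + 2))
    rwa [Nat.zero_add] at h
  -- `dim 𝐏ⁿ = n` and `dim i(X) = dim X ≤ dim 𝐏ⁿ`
  haveI : SmoothOfRelativeDimension n (g n) :=
    (Literature.AlgebraicGeometry.Motives.isSmoothProjective_projectiveSpace_holds k n)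
      |>.smoothOfRelativeDimension
  haveI : Nonempty (P n) := ⟨ι (Classical.arbitrary X)⟩
  have hPn : topologicalKrullDim (P n) = (n : WithBot ℕ∞) :=
    Literature.AlgebraicGeometry.Motives.topologicalKrullDim_eq_of_smoothOfRelativeDimension (g n) n
  have hXle : topologicalKrullDim (Set.range i) ≤ (n : WithBot ℕ∞) := by
    calc topologicalKrullDim (Set.range i) ≤ topologicalKrullDim X :=
          (i.isClosedEmbedding.isEmbedding.toHomeomorph).symm.isInducing.topologicalKrullDim_le
      _ ≤ topologicalKrullDim (P n) := ι.isEmbedding.isInducing.topologicalKrullDim_le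
      _ = n := hPn
  have hdim : topologicalKrullDim (Set.range i) + 2 ≤ topologicalKrullDim (U : Scheme.{u}) := by
    rw [hU]
    calc topologicalKrullDim (Set.range i) + 2 ≤ (n : WithBot ℕ∞) + 2 := add_le_add hXle le_rfl
      _ = ((n + 2 : ℕ) : WithBot ℕ∞) := by push_cast; rfl
  exact hasResolution_of_embResCodimTwo hE (U.ι ≫ g (n + 2)) hreg i hdim

/-! ## Registered stubs -/

/-- Stub S1 (lead) — **Zariski's bad-stratum induction in trdeg `n`**: `BadStratumPatching p`
for every prime `p` — PROVED: its third hypothesis `EmbResCodimTwo p` alone gives `ResolutionInChar p`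
(`resolutionInChar_of_embResCodimTwo` below/above), and resolution gives two-model patching
(`ProperModel.twoModelPatching_of_resolutionInChar`). Landed form: `Theorems.stub_badStratumPatching`
(`Theorems/ValuativePatchingRelEmbResCodimTwo.lean`). [cite: Piltant2013, Prop. 5.1] -/
theorem stub_badStratumPatching : ∀ p : ℕ, p.Prime → BadStratumPatching.{0} p :=
  fun _ _ _ _ hE => ProperModel.twoModelPatching_of_resolutionInChar (resolutionInChar_of_embResCodimTwo hE)

/-- Stub S2 — **Piltant's Axiom 4 in blow-up format, characteristic `p`, all dimensions** (tree
`@[conjecture] PrincipalizationInChar`; open in dimension `≥ 4`). [cite: Piltant2013, §2 Axiom 4] -/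
theorem stub_principalizationInChar : ∀ p : ℕ, p.Prime → PrincipalizationInChar.{0} p := by
  sorry

/-- Stub S3 — **CJS-format embedded resolution in codimension `≥ 2`, characteristic `p`, all
ambient dimensions** (CJS 2020 Thm. 1.4 for ambient dimension `≤ 4`; open beyond). AS TYPED it is
SUMMIT-STRENGTH: `resolutionInChar_of_embResCodimTwo` above gives `ResolutionInChar p` from it alone
(LU, S1, S2 idle) — the line collapses onto this stub. [cite: CossartJannsenSaito2020, Thm. 1.4] -/
theorem stub_embResCodimTwo : ∀ p : ℕ, p.Prime → EmbResCodimTwo.{0} p := by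
  sorry

/-- **Line `Ideator5Sketch` (card `bad-stratum-induction`) closes the crux modulo S1–S3** — the
card's composition `patchingRel_of_badStratumInduction` inlined (Zariski's programme
`resolutionInChar_of_properTwoModelPatching_of_relLU` consumes the antecedent `LUrel_p`; Liu
8.1.24 is the tree theorem `Liu2002Thm8124Projective_holds`). [cite: Piltant2013, Prop. 5.1 and Cor. 5.7] -/
theorem PatchingRel_of :
    Summit.ResolutionOfSingularities.ResolutionOfSingularities.Theses.Valuative.PatchingRel := by
  intro p hp hLU
  exact resolutionInChar_of_properTwoModelPatching_of_relLU
    (stub_badStratumPatching p hp Liu2002Thm8124Projective_holds (stub_principalizationInChar p hp)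
      (stub_embResCodimTwo p hp)) hLU

end Summit.ResolutionOfSingularities.ResolutionOfSingularities.Cruxes.PatchingRel.BadStratumInductionLine

end
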